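import Mathlib.Probability.Distributions.Gaussian.Real
import Mathlib.Analysis.SpecialFunctions.Gaussian.GaussianIntegral
import Mathlib.Analysis.SpecialFunctions.Log.Basic
import HarnessLib

/-!
# A Gaussian model of a Gaussian mode: the reweighting efficiency in closed form, and its volume law

HONEST FRAMING: exact (Metropolis-corrected) sampling algorithms for lattice gauge theory;
figures of merit are autocorrelation/cost numbers at stated couplings and volumes; no
continuum-physics claim.  (SCALAR calibration rung S0-A: not a gauge result.)

Venture `LatticeQCDFlow` (cell pub-lqcd), sub-topic `Scoring`; FANOUT row 2 (`s0-phi4`: the FLOW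
arm of the 2D φ⁴ calibration — real-NVP proposals, reweighting / independence Metropolis).  NEW
WORK of the cell (one Gaussian integral and elementary inequalities, over Mathlib); nothing is
cited as a fact.  Printed counterparts, named only: Kong–Liu–Wong 1994 / Liu 1996 (the `ESS =
N/(1 + Var w)` rule), Albergo–Kanwar–Shanahan 2019 §II.C (ESS of flow proposals), Abbott et al.
2022 (arXiv:2211.07541 §V: ESS falls exponentially with the volume at fixed model quality),
Del Debbio–Marsh Rossney–Wilson 2021.

The free-field limit of the flow arm.  A trained flow for the FREE field is, mode by mode, a
centred Gaussian model `q_k = N(0, b_k)` of the target mode `p_k = N(0, a_k)`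
(`a_k = 1/(2(κ_k + m²))` by `free_spectral_oracle_div`); the importance weight factorises over
modes and so does `E_q[w²]`.  This file computes the one-mode factor EXACTLY and turns the
product into a two-sided volume law with explicit constants — the continuum companion of the
finite-space `Scaling/ImportanceWeights.lean` (`essFrac_blockProd`) and of the log-normal
heuristic `Scaling/GaussianWeights.lean`.

## What is proved

* `gaussian_sq_div` — `p(x)²/q(x) = (√(2πb)/(2πa))·e^{−((2b−a)/(2ab))x²}` (Mathlib
  `gaussianPDFReal`); **`gaussian_weight_sq_moment`** — for `2b > a` (else `E_q[w²] = ∞`):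
  `E_q[w²] = ∫ p²/q = b/√(a(2b − a))` (Mathlib `integral_gaussian`);
  `gaussian_weight_sq_moment_ratio` — `= r/√(2r − 1)`, `r = b/a` the model/target variance ratio.
* `gaussModeESS r = √(2r − 1)/r` — the mode's reweighting efficiency `ESS/N = 1/E_q[w²]`
  (normalised weights); `gaussModeESS_one` (`= 1` at `r = 1`), **`gaussModeESS_le_one`**
  (`≤ 1`, `(r − 1)² ≥ 0`), **`gaussModeESS_inv_sq`** — the DEFECT FORM
  `(ESS/N)⁻² = 1 + (r − 1)²/(2r − 1)`: quadratic in the variance mismatch.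
* **The volume law, two-sided, explicit** (independent modes `k ∈ s`, `r_k > 1/2`,
  `u_k = (r_k − 1)²/(2r_k − 1)`, `log ESS_V = Σ_k log gaussModeESS r_k`):
  `log_prod_gaussModeESS_ge` — `log ESS_V ≥ −½ Σ_k u_k` (`log(1+u) ≤ u`);
  `log_prod_gaussModeESS_le` — `log ESS_V ≤ −½ Σ_k u_k/(1 + u_k)` (`log(1+u) ≥ u/(1+u)`).
  READING: with `V` modes each modelled to relative variance accuracy `ε` (`r_k = 1 ± ε`),
  `Σ u ≈ Vε²` and `ESS_V ≈ e^{−Vε²/2}` from both sides — an exact sampler built on such a model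
  keeps a fixed efficiency iff the per-mode accuracy improves like `ε ∝ V^{−1/2}`; at fixed model
  quality the efficiency dies exponentially in the volume (the free-field face of barrier B1 /
  `Scaling.B1_VolumeScalingOfTraining`).

NOT CLAIMED: non-Gaussian models, correlated-mode (non-diagonal) models (a linear flow can match
the free field EXACTLY — the statement is about residual mismatch, not about expressivity),
`λ > 0`, the independence-Metropolis acceptance (an `erfc`-type integral, not typed), training
dynamics.
-/

namespace Summit.Ventures.LatticeQCDFlow.Scoring

open Real MeasureTheory ProbabilityTheory

/-! ## One mode -/

/-- Pointwise: the squared target density over the model density, both centred Gaussians with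
variances `a` (target) and `b` (model), is an un-normalised Gaussian:
`p(x)²/q(x) = (√(2πb)/(2πa)) · exp(−((2b − a)/(2ab)) x²)`. -/
theorem gaussian_sq_div (a b : NNReal) (ha : a ≠ 0) (hb : b ≠ 0) (x : ℝ) :
    gaussianPDFReal 0 a x ^ 2 / gaussianPDFReal 0 b x
      = Real.sqrt (2 * π * b) / (2 * π * a)
        * Real.exp (-((2 * b - a) / (2 * a * b)) * x ^ 2) := by
  have ha' : (0 : ℝ) < a := by exact_mod_cast pos_iff_ne_zero.mpr ha
  have hb' : (0 : ℝ) < b := by exact_mod_cast pos_iff_ne_zero.mpr hb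
  simp only [gaussianPDFReal_def, sub_zero]
  have hsa : Real.sqrt (2 * π * a) ≠ 0 := (Real.sqrt_pos.mpr (by positivity)).ne'
  have hsb : Real.sqrt (2 * π * b) ≠ 0 := (Real.sqrt_pos.mpr (by positivity)).ne'
  have hsa2 : Real.sqrt (2 * π * a) ^ 2 = 2 * π * a := Real.sq_sqrt (by positivity)
  rw [mul_pow, ← Real.exp_nat_mul, inv_pow, hsa2]
  have hexp : Real.exp (-x ^ 2 / (2 * (b : ℝ))) ≠ 0 := (Real.exp_pos _).ne'
  rw [div_eq_iff (mul_ne_zero (inv_ne_zero hsb) hexp)]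
  have key : Real.exp (((2 : ℕ) : ℝ) * (-x ^ 2 / (2 * (a : ℝ))))
      = Real.exp (-((2 * b - a) / (2 * a * b)) * x ^ 2) * Real.exp (-x ^ 2 / (2 * (b : ℝ))) := by
    rw [← Real.exp_add]
    congr 1
    push_cast
    field_simp
    ring
  rw [key]
  field_simp

/-- **The second moment of the weights, exactly.**  Target `p = N(0, a)`, model `q = N(0, b)` with
`2b > a` (else the moment is infinite): `E_q[w²] = ∫ p²/q = b / √(a(2b − a))`. -/
theorem gaussian_weight_sq_moment (a b : NNReal) (ha : a ≠ 0) (hb : b ≠ 0)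
    (hab : (a : ℝ) < 2 * b) :
    ∫ x, gaussianPDFReal 0 a x ^ 2 / gaussianPDFReal 0 b x
      = (b : ℝ) / Real.sqrt (a * (2 * b - a)) := by
  have ha' : (0 : ℝ) < a := by exact_mod_cast pos_iff_ne_zero.mpr ha
  have hb' : (0 : ℝ) < b := by exact_mod_cast pos_iff_ne_zero.mpr hb
  have hc : 0 < (2 * (b : ℝ) - a) / (2 * a * b) := by
    have : 0 < 2 * (b : ℝ) - a := by linarith
    positivity
  simp only [gaussian_sq_div a b ha hb]
  rw [integral_const_mul, integral_gaussian]
  -- `√(2πb)/(2πa) · √(π (2ab)/(2b − a)) = b/√(a(2b−a))`: compare squares of positive reals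
  have h2ba : 0 < 2 * (b : ℝ) - a := by linarith
  have hL : 0 ≤ Real.sqrt (2 * π * b) / (2 * π * a) * Real.sqrt (π / ((2 * b - a) / (2 * a * b))) := by
    positivity
  have hR : 0 ≤ (b : ℝ) / Real.sqrt (a * (2 * b - a)) := by positivity
  rw [← Real.sqrt_sq hL, ← Real.sqrt_sq hR]
  congr 1
  rw [mul_pow, div_pow, div_pow, Real.sq_sqrt (by positivity), Real.sq_sqrt (by positivity),
    Real.sq_sqrt (by positivity)]
  field_simp

/-- **The reweighting efficiency of one mode**: `ESS/N = (E w)²/E[w²] = 1/E_q[w²]` (normalised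
densities, `E_q w = 1`) equals `√(a(2b − a))/b = √(2r − 1)/r` with `r = b/a` the model-to-target
variance ratio. -/
noncomputable def gaussModeESS (r : ℝ) : ℝ := Real.sqrt (2 * r - 1) / r

/-- The closed form in the ratio: `b/√(a(2b − a)) = r/√(2r − 1)`, i.e. `1/E_q[w²] = gaussModeESS r`. -/
theorem gaussian_weight_sq_moment_ratio (a b : ℝ) (ha : 0 < a) (hab : a < 2 * b) :
    b / Real.sqrt (a * (2 * b - a)) = (b / a) / Real.sqrt (2 * (b / a) - 1) := by
  have h2 : 0 < 2 * b - a := by linarith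
  have e : 2 * (b / a) - 1 = (2 * b - a) / a := by field_simp
  rw [e, Real.sqrt_div' _ ha.le, Real.sqrt_mul ha.le]
  have hsa : 0 < Real.sqrt a := Real.sqrt_pos.mpr ha
  have hs2 : 0 < Real.sqrt (2 * b - a) := Real.sqrt_pos.mpr h2
  field_simp
  rw [Real.sq_sqrt ha.le]

/-- **`ESS ≤ 1` with equality iff the variance is matched.**  For `r > 1/2`:
`√(2r − 1)/r ≤ 1` (`(r − 1)² ≥ 0`). -/
theorem gaussModeESS_le_one {r : ℝ} (hr : 1 / 2 < r) : gaussModeESS r ≤ 1 := by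
  unfold gaussModeESS
  have hr0 : 0 < r := by linarith
  rw [div_le_one hr0]
  calc Real.sqrt (2 * r - 1) ≤ Real.sqrt (r ^ 2) :=
        Real.sqrt_le_sqrt (by nlinarith [sq_nonneg (r - 1)])
    _ = r := Real.sqrt_sq hr0.le

/-- At matched variance the mode costs nothing: `gaussModeESS 1 = 1`. -/
theorem gaussModeESS_one : gaussModeESS 1 = 1 := by
  unfold gaussModeESS
  norm_num

/-- **The defect form**: `(ESS/N)⁻² = E[w²]² = r²/(2r − 1) = 1 + (r − 1)²/(2r − 1)` — the
inefficiency of a mode is quadratic in its variance mismatch. -/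
theorem gaussModeESS_inv_sq {r : ℝ} (hr : 1 / 2 < r) :
    (gaussModeESS r)⁻¹ ^ 2 = 1 + (r - 1) ^ 2 / (2 * r - 1) := by
  unfold gaussModeESS
  have h2 : 0 < 2 * r - 1 := by linarith
  have hr0 : 0 < r := by linarith
  have h2' : 2 * r - 1 ≠ 0 := h2.ne'
  rw [inv_div, div_pow, Real.sq_sqrt h2.le,
    show (1 : ℝ) + (r - 1) ^ 2 / (2 * r - 1) = ((2 * r - 1) + (r - 1) ^ 2) / (2 * r - 1) by
      rw [add_div, div_self h2']]
  congr 1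
  ring

/-! ## Many modes: the volume law with explicit constants -/

/-- **Lower bound (the flow's budget).**  For independent modes with variance ratios `r_k > 1/2`
the reweighting efficiency is the product `Π_k √(2r_k − 1)/r_k`, and
`log ESS = −½ Σ_k log(1 + u_k) ≥ −½ Σ_k u_k`, `u_k = (r_k − 1)²/(2r_k − 1)`:
a flow whose summed squared variance defects `Σ_k u_k` stay bounded keeps `ESS ≥ e^{−Σu/2}` at
every volume. -/
theorem log_prod_gaussModeESS_ge {ι : Type*} (s : Finset ι) (r : ι → ℝ)
    (hr : ∀ k ∈ s, 1 / 2 < r k) :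
    -(1 / 2) * ∑ k ∈ s, (r k - 1) ^ 2 / (2 * r k - 1)
      ≤ ∑ k ∈ s, Real.log (gaussModeESS (r k)) := by
  rw [Finset.mul_sum]
  refine Finset.sum_le_sum fun k hk => ?_
  have hrk := hr k hk
  have h2 : 0 < 2 * r k - 1 := by linarith
  have hr0 : 0 < r k := by linarith
  have hpos : 0 < gaussModeESS (r k) := by
    unfold gaussModeESS
    exact div_pos (Real.sqrt_pos.mpr h2) hr0
  -- `log ESS = −½ log(1 + u)` and `log(1 + u) ≤ u`
  have hu : 0 ≤ (r k - 1) ^ 2 / (2 * r k - 1) := by positivity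
  have hlog : Real.log (gaussModeESS (r k)) = -(1 / 2) * Real.log (1 + (r k - 1) ^ 2 / (2 * r k - 1)) := by
    rw [← gaussModeESS_inv_sq hrk, Real.log_pow, Real.log_inv]
    push_cast
    ring
  rw [hlog]
  have hle : Real.log (1 + (r k - 1) ^ 2 / (2 * r k - 1)) ≤ (r k - 1) ^ 2 / (2 * r k - 1) := by
    have := Real.add_one_le_exp ((r k - 1) ^ 2 / (2 * r k - 1))
    rw [add_comm] at this
    calc Real.log (1 + (r k - 1) ^ 2 / (2 * r k - 1))
        ≤ Real.log (Real.exp ((r k - 1) ^ 2 / (2 * r k - 1))) :=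
          Real.log_le_log (by positivity) this
      _ = (r k - 1) ^ 2 / (2 * r k - 1) := Real.log_exp _
  nlinarith

/-- **Upper bound (the barrier).**  Conversely `log(1 + u) ≥ u/(1 + u)`, so
`log ESS ≤ −½ Σ_k u_k/(1 + u_k)`: summed defects that GROW with the volume (a fixed per-mode
mismatch on `V` modes gives `Σu ∝ V`) force the efficiency down exponentially — the free-field
form of the volume law of `Scaling/ImportanceWeights.lean` / `GaussianWeights.lean`, with the
constants explicit. -/
theorem log_prod_gaussModeESS_le {ι : Type*} (s : Finset ι) (r : ι → ℝ)
    (hr : ∀ k ∈ s, 1 / 2 < r k) :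
    ∑ k ∈ s, Real.log (gaussModeESS (r k))
      ≤ -(1 / 2) * ∑ k ∈ s, ((r k - 1) ^ 2 / (2 * r k - 1)) / (1 + (r k - 1) ^ 2 / (2 * r k - 1)) := by
  rw [Finset.mul_sum]
  refine Finset.sum_le_sum fun k hk => ?_
  have hrk := hr k hk
  have h2 : 0 < 2 * r k - 1 := by linarith
  have hr0 : 0 < r k := by linarith
  set u := (r k - 1) ^ 2 / (2 * r k - 1) with hu_def
  have hu : 0 ≤ u := by positivity
  have hlog : Real.log (gaussModeESS (r k)) = -(1 / 2) * Real.log (1 + u) := by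
    rw [hu_def, ← gaussModeESS_inv_sq hrk, Real.log_pow, Real.log_inv]
    push_cast
    ring
  rw [hlog]
  -- `u/(1+u) ≤ log(1+u)`: from `log(1+u) = −log(1/(1+u)) ≥ −(1/(1+u) − 1) = u/(1+u)`
  have h1u : 0 < 1 + u := by linarith
  have hge : u / (1 + u) ≤ Real.log (1 + u) := by
    have h := Real.add_one_le_exp (-(u / (1 + u)))
    -- `1 − u/(1+u) = 1/(1+u) ≤ exp(−u/(1+u))` ⇒ `−u/(1+u) ≥ log(1/(1+u)) = −log(1+u)`
    have e : -(u / (1 + u)) + 1 = (1 + u)⁻¹ := by field_simp; ring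
    rw [e] at h
    have hlog := Real.log_le_log (by positivity) h
    rw [Real.log_exp, Real.log_inv] at hlog
    linarith
  nlinarith


/-! ## The supremum of the weight: the independence sampler's per-mode constant -/

/-- The weight of one mode in closed form: `p(x)/q(x) = √(b/a) · e^{−((b − a)/(2ab)) x²}`. -/
theorem gaussian_weight_eq (a b : NNReal) (ha : a ≠ 0) (hb : b ≠ 0) (x : ℝ) :
    gaussianPDFReal 0 a x / gaussianPDFReal 0 b x
      = Real.sqrt (b / a) * Real.exp (-((b - a) / (2 * a * b)) * x ^ 2) := by
  have ha' : (0 : ℝ) < a := by exact_mod_cast pos_iff_ne_zero.mpr ha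
  have hb' : (0 : ℝ) < b := by exact_mod_cast pos_iff_ne_zero.mpr hb
  simp only [gaussianPDFReal_def, sub_zero]
  have hsa : 0 < Real.sqrt (2 * π * a) := Real.sqrt_pos.mpr (by positivity)
  have hsb : 0 < Real.sqrt (2 * π * b) := Real.sqrt_pos.mpr (by positivity)
  have hexp : Real.exp (-x ^ 2 / (2 * (b : ℝ))) ≠ 0 := (Real.exp_pos _).ne'
  rw [div_eq_iff (mul_ne_zero (inv_ne_zero hsb.ne') hexp)]
  have key : Real.exp (-x ^ 2 / (2 * (a : ℝ)))
      = Real.exp (-((b - a) / (2 * a * b)) * x ^ 2) * Real.exp (-x ^ 2 / (2 * (b : ℝ))) := by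
    rw [← Real.exp_add]
    congr 1
    field_simp
    ring
  have hsq : Real.sqrt ((b : ℝ) / a) = Real.sqrt (2 * π * b) / Real.sqrt (2 * π * a) := by
    rw [← Real.sqrt_div' _ (by positivity : (0 : ℝ) ≤ 2 * π * a)]
    congr 1
    field_simp
  rw [key, hsq]
  field_simp

/-- The weight at the origin IS `√(b/a)`. -/
theorem gaussian_weight_zero (a b : NNReal) (ha : a ≠ 0) (hb : b ≠ 0) :
    gaussianPDFReal 0 a 0 / gaussianPDFReal 0 b 0 = Real.sqrt (b / a) := by
  rw [gaussian_weight_eq a b ha hb]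
  simp

/-- **The weight is bounded iff the model is at least as wide as the target**: for `a ≤ b`,
`p/q ≤ √(b/a) = √r` everywhere (attained at `x = 0`).  This `W = sup w` is the constant of the
independence sampler's geometric rate `1 − 1/W` (`Exactness/IMHKernel.lean`, Mengersen–Tweedie):
per mode `1 − r^{−1/2}`, and over `V` modes `W_V = Π_k √r_k = e^{½ Σ log r_k}` — exponential in
the volume at fixed over-dispersion (the continuum face of `Scaling/IMHVolumeLaw.lean`). -/
theorem gaussian_weight_le (a b : NNReal) (ha : a ≠ 0) (hb : b ≠ 0) (hab : (a : ℝ) ≤ b) (x : ℝ) :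
    gaussianPDFReal 0 a x / gaussianPDFReal 0 b x ≤ Real.sqrt (b / a) := by
  have ha' : (0 : ℝ) < a := by exact_mod_cast pos_iff_ne_zero.mpr ha
  have hb' : (0 : ℝ) < b := by exact_mod_cast pos_iff_ne_zero.mpr hb
  rw [gaussian_weight_eq a b ha hb]
  have hexp : Real.exp (-((b - a) / (2 * a * b)) * x ^ 2) ≤ 1 := by
    rw [Real.exp_le_one_iff]
    have : 0 ≤ ((b : ℝ) - a) / (2 * a * b) * x ^ 2 := by
      have : 0 ≤ (b : ℝ) - a := by linarith
      positivity
    linarith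
  calc Real.sqrt (b / a) * Real.exp (-((b - a) / (2 * a * b)) * x ^ 2)
      ≤ Real.sqrt (b / a) * 1 := mul_le_mul_of_nonneg_left hexp (Real.sqrt_nonneg _)
    _ = Real.sqrt (b / a) := mul_one _

/-- For `V` modes the product of the per-mode suprema is `exp(½ Σ_k log r_k)` (`r_k ≥ 1`). -/
theorem prod_sqrt_eq_exp_half_sum_log {ι : Type*} (s : Finset ι) (r : ι → ℝ)
    (hr : ∀ k ∈ s, 0 < r k) :
    ∏ k ∈ s, Real.sqrt (r k) = Real.exp ((1 / 2) * ∑ k ∈ s, Real.log (r k)) := by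
  rw [Finset.mul_sum, Real.exp_sum]
  refine Finset.prod_congr rfl fun k hk => ?_
  rw [Real.sqrt_eq_rpow, Real.rpow_def_of_pos (hr k hk)]
  ring_nf

end Summit.Ventures.LatticeQCDFlow.Scoring
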